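import Literature.NumberTheory.GaloisRepresentations.LubinTateColemanNorm
import HarnessLib

/-!
# Coleman's norm operator for `f = πX + X^q` on `𝒪[F]⟦X⟧`: the defining identity, multiplicativity,
de Shalit's (i), (iii), (iv)

Step P3 (concrete layer, second half) of the programme of `LocalExistenceLubinTate.lean` towards the
norm-group fact `Literature.NumberTheory.GaloisRepresentations.exists_abelian_norm_le_lubinTate`.
`LubinTateColemanNorm.lean` descends Coleman's series to the operator
`𝒩 = colemanNorm hπ n : 𝒪[F]⟦X⟧ → 𝒪[F]⟦X⟧` (computed inside `E = K_π^{n+1} = ltField π n`, with the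
Coleman family `W_f^1 = (ω_c)_{c ∈ 𝓀}`, `ω_c = ltDivPt hπ n c`).  This file proves its properties
(de Shalit, *Iwasawa theory of elliptic curves with complex multiplication* (1987), Ch. I §2.1,
Proposition, in the *absolute* case `k' = k = F`, where the Frobenius `φ` acts trivially on the
coefficients), everything **proved**:

* the dictionary between congruences in `𝒪[F]` and norms in `𝒪_E` (`mem_coeffIdeal_of_map_mem`,
  `mem_coeffIdeal_pow_succ_of_map_eq`: if `ι G = ι(π^i) · T` with the coefficients of `T` in `𝔪_E`
  then `G ≡ 0 mod π^{i+1}` — discreteness of `F`; this is de Shalit's "since `𝒩h ∈ 𝒪'⟦X⟧`, actually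
  `𝒩h ≡ 1 mod 𝔭'^{i+1}`");
* (1): `map_subst_colemanNorm` (`ι(𝒩h ∘ f) = ∏_c h(X [+] ω_c)`), `evalAt_ltSMul_colemanNorm`
  (`(𝒩h)([π]x) = ∏_c h(x [+] ω_c)` on points of `𝔪_E`); multiplicativity `colemanNorm_mul`,
  `colemanNorm_one`, `colemanNormHom`;
* (i): `colemanNorm_sub_mem_coeffIdeal` — **`𝒩h ≡ h (mod π)`** (`𝒩h(X^q) ≡ 𝒩h ∘ f ≡ h^q ≡ h(X^q)`);
* (iv): `colemanNorm_sub_one_mem_coeffIdeal` — **`h ≡ 1 (mod π^i)`, `i ≥ 1` ⟹ `𝒩h ≡ 1 (mod π^{i+1})`**,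
  and its iteration `colemanNormIter_sub_one_mem` (`𝒩^{(k)} g ≡ 1 mod π^{k+1}` for `g ≡ 1 mod π`, the
  congruence (3) of de Shalit I §2.2);
* (iii) at points: `evalAt_ltSMul_pow_colemanNormIter` — **`(𝒩^{(k)}h)([π^k]x) = ∏_{ω ∈ W_f^k} h(x [+] ω)`**
  for `k ≤ n+1`, the division points of level `k` in `𝔪_E` being the `[π^{n+1-k} · Σ_{i<k} digit(dᵢ) πⁱ] λ_{n+1}`,
  `d ∈ 𝓀^k` (induction on `k` via (1) and `Fin.snoc`), and at `x = 0`
  `prod_evalAt_eq_constantCoeff_colemanNormIter`: `(𝒩^{(k)}h)(0) = ∏_{ω ∈ W_f^k} h(ω)`;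
* `π`-adic digit expansions `exists_digits` (Serre II §4 Prop. 5) and the digit-sum identities used to
  enumerate `W_f^k` (`digitSum_snoc`, `digitSum_cons_zero`, `residue_digitSum_succ`).

On the level parameter: `colemanNorm hπ n` is built inside `K_π^{n+1}` and nominally depends on `n`
(any level gives the same operator on `𝒪[F]⟦X⟧`, but this is not needed): every identity here and in
`LubinTateNormGroup.lean` is at one fixed level `n`, relating `𝒩` to points and norms of the same field
`K_π^{n+1}`.

## References

* E. de Shalit, *Iwasawa theory of elliptic curves with complex multiplication* (1987), Ch. I §2.1
  Proposition (i)–(iv) and proof (PDF pp. 12–13), §2.2 (proof, (2)–(3), PDF pp. 13–14).  [deShalit1987]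
* J.-P. Serre, *Local class field theory*, Ch. VI of Cassels–Fröhlich (1967), §3.6.  [CasselsFrohlichANT1967]
* J.-P. Serre, *Local Fields* (1979), Ch. II §4 Prop. 5.  [SerreLocalFields1979]

## Mathlib reuse

`PowerSeries.map_subst`, `PowerSeries.map_injective`, `PowerSeries.coeff_expand_mul`, `Fin.snocEquiv`,
`Fintype.prod_equiv`, `Fintype.prod_prod_type'`, `Finset.prod_comm`, `Valuation.Integers.le_iff_dvd`;
from the tree: `LubinTateColeman.lean` (`subst_colemanSer`, `evalAt_ltSMul_eq_prod`, `nProd_mul`,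
`nProd_sub_pow_mem_coeffIdeal`, `nProd_one_add_C_mul`, `sum_transl_sub_mem_coeffIdeal`,
`subst_sub_expand_mem_coeffIdeal`, `pow_sub_expand_mem_coeffIdeal`, `mem_coeffIdeal_of_subst_mem`,
`subst_injective`), `LubinTateColemanNorm.lean` (`colemanNorm`, `map_colemanNorm`, `ltDivPt`, `ltSer`,
`evalAt_zero`, local instances), `LocalExistenceLubinTate.lean` (`valuation_le_unifValue_pow_succ_iff_lt`),
`LubinTateTorsion.lean` (`digitSum`, `genPt`).
-/

noncomputable section

open Filter Topology Polynomial ValuativeRel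
open scoped PowerSeries.WithPiTopology

namespace Literature.NumberTheory.GaloisRepresentations


section LocalFieldB

open GaloisRepresentations.IsNonarchimedeanLocalField LubinTate

variable (F : Type*) [Field F] [ValuativeRel F] [TopologicalSpace F] [IsNonarchimedeanLocalField F]

attribute [local instance] ltNormUniformSpace ltNormIsUniformAddGroup rk1 nF nE fintypeResidueField

section Operator

variable {F}
variable (E : IntermediateField F (AlgebraicClosure F)) [FiniteDimensional F E]

/-! #### Norms of coefficients: the dictionary between `𝒪[F]` and `𝒪_E` -/

/-- `‖ι a‖_E = ‖a‖_F` for `a ∈ 𝒪[F]`. [folklore] -/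
theorem norm_algebraMap_LTCoeff (a : 𝒪[F]) :
    ‖((algebraMap (LTCoeff F) (unitBall E) (LTCoeff.of F a) : unitBall E) : E)‖ = ‖(a : F)‖ := by
  change ‖algebraMap F E (a : F)‖ = _
  rw [norm_eq_spectralNorm F E, spectralNorm_extends]

/-- The coefficient map `𝒪[F] → 𝒪_E` is injective. [folklore] -/
theorem algebraMap_LTCoeff_injective :
    Function.Injective (algebraMap (LTCoeff F) (unitBall E)) := by
  intro a b h
  have h1 := congrArg (fun s : unitBall E => (s : E)) h
  change algebraMap F E ((LTCoeff.of F).symm a : F) = algebraMap F E ((LTCoeff.of F).symm b : F) at h1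
  exact (LTCoeff.of F).symm.injective (Subtype.ext ((algebraMap F E).injective h1))

variable {E}
variable {π : 𝒪[F]} (hπ : (valuation F).IsUniformizer (π : F))

include hπ in
/-- `‖a‖ < 1 ⟹ π ∣ a` in `𝒪[F]`. [folklore] -/
theorem dvd_of_norm_lt_one {a : 𝒪[F]} (h : ‖(a : F)‖ < 1) : π ∣ a :=
  dvd_of_mem_maximalIdeal F hπ ((mem_maximalIdeal_iff_valuation_lt_one _).mpr
    ((Valued.toNormedField.norm_lt_one_iff).mp h))

include hπ in
/-- **Discreteness**: `‖a‖ < ‖π‖^i ⟹ π^{i+1} ∣ a` in `𝒪[F]`. [folklore] -/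
theorem pow_succ_dvd_of_norm_lt {a : 𝒪[F]} {i : ℕ} (h : ‖(a : F)‖ < ‖(π : F)‖ ^ i) :
    π ^ (i + 1) ∣ a := by
  have h1 : valuation F (a : F) < unifValue F ^ i := by
    rw [← norm_pow, Valued.toNormedField.norm_lt_iff] at h
    rw [← show valuation F (π : F) = unifValue F from hπ, ← Valuation.map_pow]
    exact h
  rw [← valuation_le_unifValue_pow_succ_iff_lt, ← show valuation F (π : F) = unifValue F from hπ,
    ← Valuation.map_pow] at h1
  have h2 : valuation F (a : F) ≤ valuation F ((π ^ (i + 1) : 𝒪[F]) : F) := by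
    rwa [SubmonoidClass.coe_pow]
  exact (Valuation.Integers.le_iff_dvd (Valuation.integer.integers (valuation F))).mp h2

include hπ in
/-- `π ∣ x ⟹ ‖ι x‖ < 1`: multiples of `π` map into `𝔪_E`. [folklore] -/
theorem algebraMap_mem_maxNilIdeal_of_dvd {x : 𝒪[F]} (h : π ∣ x) :
    algebraMap (LTCoeff F) (unitBall E) (LTCoeff.of F x) ∈ (maxNilIdeal F E).toIdeal := by
  change ‖((algebraMap (LTCoeff F) (unitBall E) (LTCoeff.of F x) : unitBall E) : E)‖ < 1
  rw [norm_algebraMap_LTCoeff]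
  obtain ⟨y, rfl⟩ := h
  rw [Subring.coe_mul, norm_mul]
  calc ‖(π : F)‖ * ‖(y : F)‖ ≤ ‖(π : F)‖ * 1 := by
        gcongr; exact (Valued.toNormedField.norm_le_one_iff).mpr y.2
    _ < 1 := by
        rw [mul_one, Valued.toNormedField.norm_lt_one_iff]; exact hπ.val_lt_one

include hπ in
/-- `q = #𝓀[F]` maps into `𝔪_E` (`q = p^r`, `p ∈ π𝒪`). [folklore] -/
theorem natCast_residueFieldCard_mem_maxNilIdeal :
    ((residueFieldCard F : ℕ) : unitBall E) ∈ (maxNilIdeal F E).toIdeal := by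
  obtain ⟨p, r, hp, hq, hpmem⟩ := (isLTRing_LTCoeff (F := F) hπ).exists_prime
  have hr : r ≠ 0 := by
    rintro rfl
    rw [pow_zero] at hq
    exact absurd hq (one_lt_residueFieldCard F).ne'
  have h1 : ((residueFieldCard F : ℕ) : unitBall E) =
      algebraMap (LTCoeff F) (unitBall E) (LTCoeff.of F (p ^ r : 𝒪[F])) := by
    rw [map_pow, map_pow, map_natCast, map_natCast, ← Nat.cast_pow, ← hq]
  rw [h1]
  refine algebraMap_mem_maxNilIdeal_of_dvd hπ (dvd_pow ?_ hr)
  rw [Ideal.mem_span_singleton] at hpmem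
  obtain ⟨c, hc⟩ := hpmem
  exact ⟨(LTCoeff.of F).symm c, (LTCoeff.of F).injective (by rw [map_mul]; exact hc)⟩

include hπ in
/-- **Descent of congruences, level one**: if all coefficients of `ι G` lie in `𝔪_E` then
`G ≡ 0 (mod π)`. [cite: deShalit1987, Ch. I §2.1 (proof of (iv))] -/
theorem mem_coeffIdeal_of_map_mem {G : PowerSeries (LTCoeff F)}
    (hG : G.map (algebraMap (LTCoeff F) (unitBall E)) ∈ coeffIdeal (maxNilIdeal F E).toIdeal) :
    G ∈ coeffIdeal (Ideal.span {LTCoeff.of F π}) := by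
  intro k
  have h1 := hG k
  rw [PowerSeries.coeff_map] at h1
  change ‖((algebraMap (LTCoeff F) (unitBall E) (LTCoeff.of F ((LTCoeff.of F).symm
    (PowerSeries.coeff k G))) : unitBall E) : E)‖ < 1 at h1
  rw [norm_algebraMap_LTCoeff] at h1
  rw [Ideal.mem_span_singleton]
  obtain ⟨c, hc⟩ := dvd_of_norm_lt_one hπ h1
  exact ⟨LTCoeff.of F c, by rw [← map_mul, ← hc]; rfl⟩

include hπ in
/-- **Descent of congruences, higher levels**: if `ι G = ι(π^i) · T` with all coefficients of `T`
in `𝔪_E`, then `G ≡ 0 (mod π^{i+1})` ("since `𝒩h ∈ 𝒪'⟦X⟧`, actually `𝒩h ≡ 1 mod 𝔭'^{i+1}`").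
[cite: deShalit1987, Ch. I §2.1 (proof of (iv))] -/
theorem mem_coeffIdeal_pow_succ_of_map_eq {G : PowerSeries (LTCoeff F)} {i : ℕ}
    {T : PowerSeries (unitBall E)} (hT : T ∈ coeffIdeal (maxNilIdeal F E).toIdeal)
    (hG : G.map (algebraMap (LTCoeff F) (unitBall E)) =
      PowerSeries.C (algebraMap (LTCoeff F) (unitBall E) (LTCoeff.of F π ^ i)) * T) :
    G ∈ coeffIdeal (Ideal.span {LTCoeff.of F π ^ (i + 1)}) := by
  intro k
  have h1 := congrArg (PowerSeries.coeff k) hG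
  rw [PowerSeries.coeff_map, PowerSeries.coeff_C_mul] at h1
  have h2 : ‖(((LTCoeff.of F).symm (PowerSeries.coeff k G) : 𝒪[F]) : F)‖ < ‖(π : F)‖ ^ i := by
    rw [← norm_algebraMap_LTCoeff E, ← norm_algebraMap_LTCoeff E, ← norm_pow, ← SubmonoidClass.coe_pow,
      ← map_pow, ← map_pow]
    change ‖((algebraMap (LTCoeff F) (unitBall E) (PowerSeries.coeff k G) : unitBall E) : E)‖ < _
    rw [h1, Subring.coe_mul, norm_mul]
    have hT' : ‖((PowerSeries.coeff k T : unitBall E) : E)‖ < 1 := hT k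
    have hpos : 0 < ‖((algebraMap (LTCoeff F) (unitBall E) (LTCoeff.of F π ^ i) : unitBall E) : E)‖ := by
      rw [← map_pow, norm_algebraMap_LTCoeff, SubmonoidClass.coe_pow, norm_pow]
      exact pow_pos (norm_pos_iff.mpr hπ.ne_zero) _
    calc _ < ‖((algebraMap (LTCoeff F) (unitBall E) (LTCoeff.of F π ^ i) : unitBall E) : E)‖ * 1 :=
          mul_lt_mul_of_pos_left hT' hpos
      _ = _ := mul_one _
  rw [Ideal.mem_span_singleton]
  obtain ⟨c, hc⟩ := pow_succ_dvd_of_norm_lt hπ h2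
  exact ⟨LTCoeff.of F c, by rw [← map_pow, ← map_mul, ← hc]; rfl⟩

/-! #### The norm operator on `𝒪[F]⟦X⟧`: multiplicativity, values, congruences -/

variable (n : ℕ)

/-- `𝒩h ∘ f` maps to the Coleman product `∏_c h(X [+] ω_c)`.
[cite: deShalit1987, Ch. I §2.1 (1)] -/
theorem map_subst_colemanNorm (h : PowerSeries (LTCoeff F)) :
    PowerSeries.map (algebraMap (LTCoeff F) (unitBall (ltField π n)))
      (PowerSeries.subst (ltSer F π) (colemanNorm hπ n h)) =
      nProd (maxNilIdeal F (ltField π n)) (isLTRing_LTCoeff hπ) (isLTSeries_LTCoeff π) (ltDivPt hπ n) h := by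
  have e : PowerSeries.map (algebraMap (LTCoeff F) (unitBall (ltField π n)))
      (PowerSeries.subst (ltSer F π) (colemanNorm hπ n h)) =
      PowerSeries.subst ((ltSer F π).map (algebraMap (LTCoeff F) (unitBall (ltField π n))))
        ((colemanNorm hπ n h).map (algebraMap (LTCoeff F) (unitBall (ltField π n)))) :=
    PowerSeries.map_subst (PowerSeries.HasSubst.of_constantCoeff_zero'
      (isLTSeries_ltSer π).constantCoeff_eq_zero) _
  rw [e, map_colemanNorm]
  exact subst_colemanSer (isColemanFamily_ltDivPt hπ n) h

/-- **`𝒩` is multiplicative.** [cite: deShalit1987, Ch. I §2.1 Proposition] -/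
theorem colemanNorm_mul (h h' : PowerSeries (LTCoeff F)) : colemanNorm hπ n (h * h') = colemanNorm hπ n h * colemanNorm hπ n h' := by
  have hfs : PowerSeries.HasSubst (ltSer F π) :=
    PowerSeries.HasSubst.of_constantCoeff_zero' (isLTSeries_ltSer π).constantCoeff_eq_zero
  refine subst_injective (isLTRing_LTCoeff hπ) (isLTSeries_ltSer π) ?_
  change PowerSeries.subst (ltSer F π) (colemanNorm hπ n (h * h')) =
    PowerSeries.subst (ltSer F π) (colemanNorm hπ n h * colemanNorm hπ n h')
  refine PowerSeries.map_injective _ (algebraMap_LTCoeff_injective (ltField π n)) ?_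
  rw [map_subst_colemanNorm, PowerSeries.subst_mul hfs, map_mul, map_subst_colemanNorm, map_subst_colemanNorm, nProd_mul]

/-- `𝒩 1 = 1`. [folklore] -/
theorem colemanNorm_one : colemanNorm hπ n 1 = 1 := by
  refine subst_injective (isLTRing_LTCoeff hπ) (isLTSeries_ltSer π) ?_
  change PowerSeries.subst (ltSer F π) (colemanNorm hπ n 1) = PowerSeries.subst (ltSer F π) 1
  refine PowerSeries.map_injective _ (algebraMap_LTCoeff_injective (ltField π n)) ?_
  rw [map_subst_colemanNorm, subst_one (isLTSeries_ltSer π), map_one, nProd_one]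

/-- `𝒩` as a monoid homomorphism of `𝒪[F]⟦X⟧`. [cite: deShalit1987, Ch. I §2.1 Proposition] -/
def colemanNormHom : PowerSeries (LTCoeff F) →* PowerSeries (LTCoeff F) where
  toFun := colemanNorm hπ n
  map_one' := colemanNorm_one hπ n
  map_mul' := colemanNorm_mul hπ n

/-- `colemanNormHom` is `𝒩` (unfolding). [folklore] -/
@[simp] theorem colemanNormHom_apply (h : PowerSeries (LTCoeff F)) : colemanNormHom hπ n h = colemanNorm hπ n h := rfl

/-- **`(𝒩h)([π] x) = ∏_c h(x [+] ω_c)`** on points of `𝔪_{K_π^{n+1}}` (the defining identity (1) at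
points). [cite: deShalit1987, Ch. I §2.1 (1)] -/
theorem evalAt_ltSMul_colemanNorm (h : PowerSeries (LTCoeff F)) (x : (maxNilIdeal F (ltField π n)).toIdeal) :
    evalAt (maxNilIdeal F (ltField π n)) (ltSMul (maxNilIdeal F (ltField π n)) (isLTRing_LTCoeff hπ)
      (isLTSeries_LTCoeff π) (LTCoeff.of F π) x) (colemanNorm hπ n h) =
      ∏ c : 𝓀[F], evalAt (maxNilIdeal F (ltField π n)) (ltAdd (maxNilIdeal F (ltField π n))
        (isLTRing_LTCoeff hπ) (isLTSeries_LTCoeff π) x (ltDivPt hπ n c)) h := by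
  refine evalAt_ltSMul_eq_prod (hA := isLTRing_LTCoeff hπ) (hf := isLTSeries_ltSer π) ?_ x
  have e : PowerSeries.map (algebraMap (LTCoeff F) (unitBall (ltField π n)))
      (PowerSeries.subst (ltSer F π) (colemanNorm hπ n h)) =
      PowerSeries.subst ((ltSer F π).map (algebraMap (LTCoeff F) (unitBall (ltField π n))))
        ((colemanNorm hπ n h).map (algebraMap (LTCoeff F) (unitBall (ltField π n)))) :=
    PowerSeries.map_subst (PowerSeries.HasSubst.of_constantCoeff_zero'
      (isLTSeries_ltSer π).constantCoeff_eq_zero) _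
  rw [← e, map_subst_colemanNorm]

/-- **de Shalit's (i) in the absolute case: `𝒩h ≡ h (mod π)`** for `h ∈ 𝒪[F]⟦X⟧`
(`𝒩h(X^q) ≡ 𝒩h ∘ f ≡ h^q ≡ h(X^q)`). [cite: deShalit1987, Ch. I §2.1 Proposition (i)] -/
theorem colemanNorm_sub_mem_coeffIdeal (h : PowerSeries (LTCoeff F)) :
    colemanNorm hπ n h - h ∈ coeffIdeal (Ideal.span {LTCoeff.of F π}) := by
  have hq : residueFieldCard F ≠ 0 := by have := one_lt_residueFieldCard F; omega
  -- `𝒩h ∘ f ≡ h^q (mod π)` by descent from `𝔪_E`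
  have h1 : PowerSeries.subst (ltSer F π) (colemanNorm hπ n h) - h ^ residueFieldCard F ∈
      coeffIdeal (Ideal.span {LTCoeff.of F π}) := by
    refine mem_coeffIdeal_of_map_mem hπ (E := ltField π n) ?_
    rw [map_sub, map_pow, map_subst_colemanNorm]
    have h2 := nProd_sub_pow_mem_coeffIdeal (maxNilIdeal F (ltField π n)) (isLTRing_LTCoeff hπ)
      (isLTSeries_LTCoeff π) (ltDivPt hπ n) (maxNilIdeal F (ltField π n)).toIdeal
      (maxNilIdeal F (ltField π n)).isClosed (fun c => (ltDivPt hπ n c).2) h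
    have hcard : Fintype.card 𝓀[F] = residueFieldCard F := by
      rw [residueFieldCard, Nat.card_eq_fintype_card]
    rwa [hcard] at h2
  -- combine with `𝒩h ∘ f ≡ 𝒩h(X^q)` and `h^q ≡ h(X^q)`
  have h3 := subst_sub_expand_mem_coeffIdeal (isLTSeries_ltSer π) hq (colemanNorm hπ n h)
  have h4 := pow_sub_expand_mem_coeffIdeal (isLTRing_LTCoeff hπ) hq h
  have h5 : PowerSeries.expand (residueFieldCard F) hq (colemanNorm hπ n h - h) ∈
      coeffIdeal (Ideal.span {LTCoeff.of F π}) := by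
    have e : PowerSeries.expand (residueFieldCard F) hq (colemanNorm hπ n h - h) =
        (PowerSeries.subst (ltSer F π) (colemanNorm hπ n h) - h ^ residueFieldCard F) +
          (h ^ residueFieldCard F - PowerSeries.expand (residueFieldCard F) hq h) -
          (PowerSeries.subst (ltSer F π) (colemanNorm hπ n h) -
            PowerSeries.expand (residueFieldCard F) hq (colemanNorm hπ n h)) := by
      rw [map_sub]; ring
    rw [e]
    exact sub_mem (add_mem h1 h4) h3
  intro k
  have := h5 (residueFieldCard F * k)
  rwa [PowerSeries.coeff_expand_mul] at this

/-- **de Shalit's (iv): `h ≡ 1 (mod π^i)`, `i ≥ 1` ⟹ `𝒩h ≡ 1 (mod π^{i+1})`.**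
[cite: deShalit1987, Ch. I §2.1 Proposition (iv)] -/
theorem colemanNorm_sub_one_mem_coeffIdeal {h : PowerSeries (LTCoeff F)} {i : ℕ} (hi : 0 < i)
    (hh : h - 1 ∈ coeffIdeal (Ideal.span {LTCoeff.of F π ^ i})) :
    colemanNorm hπ n h - 1 ∈ coeffIdeal (Ideal.span {LTCoeff.of F π ^ (i + 1)}) := by
  have hq : residueFieldCard F ≠ 0 := by have := one_lt_residueFieldCard F; omega
  obtain ⟨h₁, hh₁⟩ := exists_eq_C_mul_of_mem_coeffIdeal_span hh
  have hh' : h = 1 + PowerSeries.C (LTCoeff.of F π ^ i) * h₁ := by rw [← hh₁, add_sub_cancel]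
  obtain ⟨Rm, hR⟩ := nProd_one_add_C_mul (maxNilIdeal F (ltField π n)) (isLTRing_LTCoeff hπ)
    (isLTSeries_ltSer π) (ltDivPt hπ n) (LTCoeff.of F π ^ i) h₁
  -- the bracket `T = Σ h₁(X [+] ω_c) + π^i R` has coefficients in `𝔪_E`
  set T := ∑ c, transl (maxNilIdeal F (ltField π n)) (isLTRing_LTCoeff hπ) (isLTSeries_ltSer π)
    (ltDivPt hπ n c) h₁ + PowerSeries.C (algebraMap (LTCoeff F) (unitBall (ltField π n))
      (LTCoeff.of F π ^ i)) * Rm with hT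
  have hTmem : T ∈ coeffIdeal (maxNilIdeal F (ltField π n)).toIdeal := by
    refine add_mem ?_ (C_mul_mem_coeffIdeal ?_ _)
    · have h2 := sum_transl_sub_mem_coeffIdeal (maxNilIdeal F (ltField π n)) (isLTRing_LTCoeff hπ)
        (isLTSeries_ltSer π) (ltDivPt hπ n) (maxNilIdeal F (ltField π n)).toIdeal
        (maxNilIdeal F (ltField π n)).isClosed (fun c => (ltDivPt hπ n c).2) h₁
      have h3 : (Fintype.card 𝓀[F] : PowerSeries (unitBall (ltField π n))) *
          h₁.map (algebraMap (LTCoeff F) (unitBall (ltField π n))) ∈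
          coeffIdeal (maxNilIdeal F (ltField π n)).toIdeal := by
        rw [show (Fintype.card 𝓀[F] : PowerSeries (unitBall (ltField π n))) =
          PowerSeries.C ((Fintype.card 𝓀[F] : ℕ) : unitBall (ltField π n)) by rw [map_natCast]]
        refine C_mul_mem_coeffIdeal ?_ _
        have hcard : Fintype.card 𝓀[F] = residueFieldCard F := by
          rw [residueFieldCard, Nat.card_eq_fintype_card]
        rw [hcard]
        exact natCast_residueFieldCard_mem_maxNilIdeal hπ
      have := add_mem h2 h3
      rwa [sub_add_cancel] at this
    · rw [map_pow]
      exact Ideal.pow_mem_of_mem _ (algebraMap_mem_maxNilIdeal_of_dvd hπ dvd_rfl) _ hi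
  -- `(𝒩h ∘ f - 1)` maps to `π^i · T`
  refine mem_coeffIdeal_of_subst_mem (isLTRing_LTCoeff hπ) (isLTSeries_ltSer π) hq (i + 1) ?_
  refine mem_coeffIdeal_pow_succ_of_map_eq hπ hTmem ?_
  rw [PowerSeries.subst_sub (PowerSeries.HasSubst.of_constantCoeff_zero'
    (isLTSeries_ltSer π).constantCoeff_eq_zero), map_sub, map_subst_colemanNorm,
    subst_one (isLTSeries_ltSer π), map_one, hh', hR, add_sub_cancel_left]

end Operator

section Iterate

variable {F}
variable {π : 𝒪[F]} (hπ : (valuation F).IsUniformizer (π : F)) (n : ℕ)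

/-! #### Digit sums -/

omit hπ in
/-- The empty residueDigit sum is `0`. [folklore] -/
theorem digitSum_fin_zero (s : 𝓀[F] → 𝒪[F]) (d : Fin 0 → 𝓀[F]) : digitSum (π := π) s d = 0 := by
  rw [digitSum, Fin.sum_univ_zero]

omit hπ in
/-- Appending a top residueDigit: `Σ_{i ≤ m} = Σ_{i < m} + s(c) π^m`. [folklore] -/
theorem digitSum_snoc (s : 𝓀[F] → 𝒪[F]) {m : ℕ} (d : Fin m → 𝓀[F]) (c : 𝓀[F]) :
    digitSum (π := π) s (Fin.snoc d c : Fin (m + 1) → 𝓀[F]) = digitSum (π := π) s d + s c * π ^ m := by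
  rw [digitSum, digitSum, Fin.sum_univ_castSucc]
  simp only [Fin.snoc_castSucc, Fin.snoc_last, Fin.val_castSucc, Fin.val_last]

omit hπ in
/-- Prepending the residueDigit `0`: `Σ_i residueDigit(d'_i) π^i = π · Σ_i residueDigit(d_{i}) π^i` for `d' = (0, d)`
(`residueDigit 0 = 0`). [folklore] -/
theorem digitSum_cons_zero {m : ℕ} (d : Fin m → 𝓀[F]) :
    digitSum (π := π) (residueDigit F) (Fin.cons 0 d : Fin (m + 1) → 𝓀[F]) = π * digitSum (π := π) (residueDigit F) d := by
  rw [digitSum, digitSum, Fin.sum_univ_succ, Finset.mul_sum]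
  simp only [Fin.cons_zero, Fin.cons_succ, residueDigit_zero, zero_mul, zero_add, Fin.val_succ, pow_succ]
  exact Finset.sum_congr rfl fun i _ => by ring

omit hπ in
/-- Digit sums reduce to their `0`-th residueDigit modulo `π`. [folklore] -/
theorem residue_digitSum_succ {m : ℕ} (d : Fin (m + 1) → 𝓀[F]) (hπm : π ∈ 𝓂[F]) :
    IsLocalRing.residue 𝒪[F] (digitSum (π := π) (residueDigit F) d) = d 0 := by
  rw [digitSum, Fin.sum_univ_succ, map_add, map_sum]
  simp only [Fin.val_zero, pow_zero, mul_one, residue_residueDigit, Fin.val_succ, pow_succ, map_mul,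
    (IsLocalRing.residue_eq_zero_iff π).mpr hπm, mul_zero, Finset.sum_const_zero, add_zero]

include hπ in
/-- **Every element of `𝒪[F]` has a `π`-adic residueDigit expansion modulo `π^m`.**
Ref: Serre, *Local Fields*, Ch. II §4 Prop. 5. [cite: SerreLocalFields1979, Ch. II §4 Prop. 5] -/
theorem exists_digits (m : ℕ) (a : 𝒪[F]) :
    ∃ d : Fin m → 𝓀[F], π ^ m ∣ a - digitSum (π := π) (residueDigit F) d := by
  induction m generalizing a with
  | zero => exact ⟨Fin.elim0, by rw [pow_zero]; exact one_dvd _⟩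
  | succ m ih =>
    have h1 : π ∣ a - residueDigit F (IsLocalRing.residue 𝒪[F] a) := by
      refine dvd_of_mem_maximalIdeal F hπ ?_
      rw [← IsLocalRing.residue_eq_zero_iff, map_sub, residue_residueDigit, sub_self]
    obtain ⟨a', ha'⟩ := h1
    obtain ⟨d, hd⟩ := ih a'
    refine ⟨Fin.cons (IsLocalRing.residue 𝒪[F] a) d, ?_⟩
    have e : a - digitSum (π := π) (residueDigit F) (Fin.cons (IsLocalRing.residue 𝒪[F] a) d : Fin (m + 1) → 𝓀[F])
        = π * (a' - digitSum (π := π) (residueDigit F) d) := by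
      rw [digitSum, Fin.sum_univ_succ]
      simp only [Fin.cons_zero, Fin.cons_succ, Fin.val_zero, pow_zero, mul_one, Fin.val_succ, pow_succ]
      rw [mul_sub, ← ha', digitSum, Finset.mul_sum, sub_add_eq_sub_sub]
      congr 1
      exact Finset.sum_congr rfl fun i _ => by ring
    rw [e, pow_succ']
    exact mul_dvd_mul_left π hd

/-! #### The iterates `𝒩^{(k)}` -/

/-- The iterated norm operator `𝒩^{(k)}` (in the absolute case `φ = id`, so `𝒩_f^{(k)} = 𝒩 ∘ ⋯ ∘ 𝒩`).
[cite: deShalit1987, Ch. I §2.1 Proposition (iii)] -/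
def colemanNormIter (k : ℕ) (h : PowerSeries (LTCoeff F)) : PowerSeries (LTCoeff F) := (colemanNorm hπ n)^[k] h

/-- `𝒩^{(0)} = id`. [folklore] -/
@[simp] theorem colemanNormIter_zero (h : PowerSeries (LTCoeff F)) : colemanNormIter hπ n 0 h = h := rfl

/-- `𝒩^{(k+1)} h = 𝒩^{(k)} (𝒩 h)`. [folklore] -/
theorem colemanNormIter_succ (k : ℕ) (h : PowerSeries (LTCoeff F)) :
    colemanNormIter hπ n (k + 1) h = colemanNormIter hπ n k (colemanNorm hπ n h) :=
  Function.iterate_succ_apply _ _ _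

/-- `𝒩^{(k+1)} h = 𝒩 (𝒩^{(k)} h)`. [folklore] -/
theorem colemanNormIter_succ' (k : ℕ) (h : PowerSeries (LTCoeff F)) :
    colemanNormIter hπ n (k + 1) h = colemanNorm hπ n (colemanNormIter hπ n k h) :=
  Function.iterate_succ_apply' _ _ _

/-- `𝒩^{(k)}` is multiplicative. [folklore] -/
theorem colemanNormIter_mul (k : ℕ) (h h' : PowerSeries (LTCoeff F)) :
    colemanNormIter hπ n k (h * h') = colemanNormIter hπ n k h * colemanNormIter hπ n k h' := by
  induction k generalizing h h' with
  | zero => rfl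
  | succ k ih => rw [colemanNormIter_succ, colemanNormIter_succ, colemanNormIter_succ, colemanNorm_mul, ih]

/-- `𝒩^{(k)} 1 = 1`. [folklore] -/
theorem colemanNormIter_one (k : ℕ) : colemanNormIter hπ n k 1 = 1 := by
  induction k with
  | zero => rfl
  | succ k ih => rw [colemanNormIter_succ', ih, colemanNorm_one]

/-- `𝒩^{(k)}` preserves units. [folklore] -/
theorem isUnit_colemanNormIter (k : ℕ) {h : PowerSeries (LTCoeff F)} (hh : IsUnit h) : IsUnit (colemanNormIter hπ n k h) := by
  obtain ⟨u, rfl⟩ := hh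
  refine IsUnit.of_mul_eq_one (colemanNormIter hπ n k (↑u⁻¹ : PowerSeries (LTCoeff F))) ?_
  rw [← colemanNormIter_mul, Units.mul_inv, colemanNormIter_one]

/-- **Successive application of (iv)**: `g ≡ 1 (mod π)` ⟹ `𝒩^{(k)} g ≡ 1 (mod π^{k+1})`.
[cite: deShalit1987, Ch. I §2.2 (proof, (3))] -/
theorem colemanNormIter_sub_one_mem (k : ℕ) {g : PowerSeries (LTCoeff F)}
    (hg : g - 1 ∈ coeffIdeal (Ideal.span {LTCoeff.of F π})) :
    colemanNormIter hπ n k g - 1 ∈ coeffIdeal (Ideal.span {LTCoeff.of F π ^ (k + 1)}) := by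
  induction k with
  | zero => rwa [colemanNormIter_zero, zero_add, pow_one]
  | succ k ih =>
    rw [colemanNormIter_succ']
    exact colemanNorm_sub_one_mem_coeffIdeal hπ n (Nat.succ_pos k) ih

/-! #### The product formula (de Shalit's (iii) at points) -/

/-- **`(𝒩^{(k)} h)([π^k] x) = ∏_{ω ∈ W_f^k} h(x [+] ω)`** on points of `𝔪_{K_π^{n+1}}` (`k ≤ n + 1`), the
division points of level `k` being the `[π^{n+1-k} · Σ_{i<k} residueDigit(dᵢ) πⁱ] λ_{n+1}`, `d ∈ 𝓀^k`.
[cite: deShalit1987, Ch. I §2.1 Proposition (iii)] -/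
theorem evalAt_ltSMul_pow_colemanNormIter (k : ℕ) (hk : k ≤ n + 1) (h : PowerSeries (LTCoeff F))
    (x : (maxNilIdeal F (ltField π n)).toIdeal) :
    evalAt (maxNilIdeal F (ltField π n)) (ltSMul (maxNilIdeal F (ltField π n)) (isLTRing_LTCoeff hπ)
      (isLTSeries_LTCoeff π) (LTCoeff.of F π ^ k) x) (colemanNormIter hπ n k h) =
      ∏ d : Fin k → 𝓀[F], evalAt (maxNilIdeal F (ltField π n))
        (ltAdd (maxNilIdeal F (ltField π n)) (isLTRing_LTCoeff hπ) (isLTSeries_LTCoeff π) x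
          (ltSMul (maxNilIdeal F (ltField π n)) (isLTRing_LTCoeff hπ) (isLTSeries_LTCoeff π)
            (LTCoeff.of F (π ^ (n + 1 - k) * digitSum (π := π) (residueDigit F) d)) (genPt hπ n))) h := by
  induction k generalizing h x with
  | zero =>
    rw [pow_zero, one_ltSMul, colemanNormIter_zero, Fintype.prod_unique, digitSum_fin_zero, mul_zero, map_zero,
      zero_ltSMul, ltAdd_zero]
  | succ k ih =>
    have hkn : k ≤ n := by omega
    rw [colemanNormIter_succ, pow_succ, mul_ltSMul, ih (by omega)]
    -- each factor: `(𝒩h)([π]x [+] [π^{n+1-k} D]λ) = (𝒩h)([π](x [+] [π^{n-k} D]λ)) = ∏_c h(x [+] …)`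
    have step : ∀ d : Fin k → 𝓀[F],
        evalAt (maxNilIdeal F (ltField π n))
          (ltAdd (maxNilIdeal F (ltField π n)) (isLTRing_LTCoeff hπ) (isLTSeries_LTCoeff π)
            (ltSMul (maxNilIdeal F (ltField π n)) (isLTRing_LTCoeff hπ) (isLTSeries_LTCoeff π)
              (LTCoeff.of F π) x)
            (ltSMul (maxNilIdeal F (ltField π n)) (isLTRing_LTCoeff hπ) (isLTSeries_LTCoeff π)
              (LTCoeff.of F (π ^ (n + 1 - k) * digitSum (π := π) (residueDigit F) d)) (genPt hπ n)))
          (colemanNorm hπ n h) =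
        ∏ c : 𝓀[F], evalAt (maxNilIdeal F (ltField π n))
          (ltAdd (maxNilIdeal F (ltField π n)) (isLTRing_LTCoeff hπ) (isLTSeries_LTCoeff π) x
            (ltSMul (maxNilIdeal F (ltField π n)) (isLTRing_LTCoeff hπ) (isLTSeries_LTCoeff π)
              (LTCoeff.of F (π ^ (n + 1 - (k + 1)) *
                digitSum (π := π) (residueDigit F) (Fin.snoc d c : Fin (k + 1) → 𝓀[F]))) (genPt hπ n))) h := by
      intro d
      have e1 : π ^ (n + 1 - k) * digitSum (π := π) (residueDigit F) d =
          π * (π ^ (n - k) * digitSum (π := π) (residueDigit F) d) := by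
        rw [← mul_assoc, ← pow_succ', show n - k + 1 = n + 1 - k by omega]
      rw [e1, map_mul, mul_ltSMul, ← ltSMul_ltAdd, evalAt_ltSMul_colemanNorm]
      refine Finset.prod_congr rfl fun c _ => ?_
      have e2 : π ^ (n - k) * digitSum (π := π) (residueDigit F) d + π ^ n * residueDigit F c =
          π ^ (n + 1 - (k + 1)) * digitSum (π := π) (residueDigit F) (Fin.snoc d c : Fin (k + 1) → 𝓀[F]) := by
        rw [digitSum_snoc, show n + 1 - (k + 1) = n - k by omega]
        obtain ⟨j, hj⟩ : ∃ j, n = j + k := ⟨n - k, by omega⟩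
        rw [show n - k = j by omega, hj, pow_add]
        ring
      rw [ltAdd_assoc, ltDivPt, ← add_ltSMul, ← map_add, e2]
    simp_rw [step]
    -- regroup `∏_d ∏_c` as a product over `𝓀^{k+1}` via `Fin.snoc`
    rw [Finset.prod_comm, ← Fintype.prod_prod_type' (f := fun c d => _)]
    exact Fintype.prod_equiv (Fin.snocEquiv fun _ => 𝓀[F]) _ _ (fun p => rfl)

/-- **`(𝒩^{(k)} h)(0) = ∏_{ω ∈ W_f^k} h(ω)`** (`k ≤ n+1`): the product formula at `x = 0`.
[cite: deShalit1987, Ch. I §2.1 Proposition (iii)] -/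
theorem prod_evalAt_eq_constantCoeff_colemanNormIter (k : ℕ) (hk : k ≤ n + 1) (h : PowerSeries (LTCoeff F)) :
    ∏ d : Fin k → 𝓀[F], evalAt (maxNilIdeal F (ltField π n))
        (ltSMul (maxNilIdeal F (ltField π n)) (isLTRing_LTCoeff hπ) (isLTSeries_LTCoeff π)
          (LTCoeff.of F (π ^ (n + 1 - k) * digitSum (π := π) (residueDigit F) d)) (genPt hπ n)) h =
      algebraMap (LTCoeff F) (unitBall (ltField π n)) (PowerSeries.constantCoeff (colemanNormIter hπ n k h)) := by
  have e := evalAt_ltSMul_pow_colemanNormIter hπ n k hk h 0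
  rw [ltSMul_zero, evalAt_zero] at e
  rw [e]
  exact Finset.prod_congr rfl fun d _ => by rw [zero_ltAdd]

end Iterate

end LocalFieldB

end Literature.NumberTheory.GaloisRepresentations
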